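import Summits.Ventures.QEC.Thresholds.RotatedSurfaceCodeSAWThresholds
import Summits.Ventures.QEC.Thresholds.DepolarizingThresholdConverses
import Literature.InformationTheory.QuantumCodes.RotatedSurfaceCodeCrossingPathsBoundZ
import HarnessLib

/-!
# Rotated surface codes `RSC(L)`, code capacity, `H_Z` sector for EVERY size: the SAW-counting threshold `p₀(μ) > .0357` for
# every minimum-weight / MWPM decoder family, both sectors and depolarizing `> .0535` — unconditional, tier CERTIFIED (kernel)

Venture QEC, `Summits/Ventures/QEC/Thresholds/` (LADDER-QEC rung Q5, PARTITION row 09; qec-type-09 gen 6, item «09.RSCZ2», the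
second lift). `RotatedSurfaceCodeSAWThresholds.lean` (item 144) certifies `p_c ≥ p₀(2.6939) > .0357` for the `H_X` sector of
every `RSC(L)`; `RotatedSurfaceCodeSAWThresholdsDual.lean` (item 146) transported it to the `H_Z` sector for ODD `L` by the
quarter turn. For EVEN `L` no isometry exchanges the colours, so the Literature files `RotatedSurfaceCodeLiftZ.lean` /
`RotatedSurfaceCodeCrossingPathsZ.lean` / `RotatedSurfaceCodeCrossingPathsBoundZ.lean` redo Dennis–Kitaev–Landahl–Preskill's
relative-polygon count directly on the `Z`-check graph (rough edges = qubit ROWS `0` and `L-1`): a failing minimum-weight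
correction of the `H_Z` sector leaves a residual with an odd number of row-`0` qubits, containing a rough-to-rough
self-avoiding path with `n ≥ L` bonds at least half faulty; `Prob ≤ L·C·r^L/(1-r)`. Here, for EVERY `L`:

| theorem | statement | tier |
|---|---|---|
| `rsc_xlogical_add_col_mem`, `rsc_rowZero_eq_one`, `rsc_oddResidualZ_of_not_corrects` | one logical qubit: every non-trivial `X`-logical is `col 0 +` an `X`-stabilizer, hence has an odd number of row-`0` qubits; failure ⇒ odd residual | CERTIFIED (kernel) |
| `rsc_x_belowThreshold_of_sawCountBound`, `rsc_x_isThresholdLowerBound_of_connectiveConstant_le` | `cₙ ≤ C νⁿ ⇒` below threshold for `4ν²p(1-p) < 1`; `μ(ℤ²) ≤ μ' ⇒ p_c ≥ p₀(μ')` — every minimum-weight decoder family of the `H_Z` sector | CERTIFIED (kernel), parametric |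
| ★ `rsc_x_isThresholdLowerBound_kernelSymmK16`, `rsc_x_accuracyThreshold_gt_0357`, `rsc_x_accuracyThreshold_minWeight_gt_0357`, `rsc_x_decaysExponentially_0357`, `rsc_x_mwpm_accuracyThreshold_gt_0357` | **`p_c(RSC(L), H_Z sector) > .0357` for EVERY `L`** (was `.0285` for even `L`), canonical instance, decay, every boundary-MWPM family | CERTIFIED (kernel), unconditional |
| `rsc_bothSectors_belowThreshold_0357`, ★ `rsc_depolarizing_isThresholdLowerBound_kernelSymmK16`, `rsc_depolarizing_accuracyThreshold_gt_0535` (+ `minWeight`), `rsc_depolarizing_accuracyThreshold_mem_kernelSymmK16` | both sectors below `.0357`; **`p_c^depol(RSC(L)) > .0535`** for EVERY `L` (was `.0427`); window `(3/2)·p₀(2.6939) ≤ p_c^depol ≤ 3/8` | CERTIFIED (kernel), unconditional |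

HONEST FRAMING: certified LOWER bounds at the kernel certificate `μ(ℤ²) ≤ 2.6939`; DKLP's printed `.0373` and the numerical
`.1031` (Wang–Harrington–Preskill) are CLAIMS, not asserted. No `native_decide`, no named fact.

## References

* [DennisEtAl2002] E. Dennis, A. Kitaev, A. Landahl, J. Preskill, *Topological quantum memory*, J. Math. Phys. 43 (2002)
  4452–4505, arXiv:quant-ph/0110143, §3.2, §4.1, §4.3, §5.2–5.3 (eqs. (e_ineq), (28), (29), (threshold_2d), (p_c_2d),
  (fail_2d); "This change has no effect on the estimate of the threshold").
* [TomitaSvore2014] Y. Tomita, K. M. Svore, PRA 90 (2014) 062320, §2.2 (Surface-17, one logical qubit).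
* [PonitzTittmann2000] A. Pönitz, P. Tittmann, Electron. J. Combin. 7 (2000) R21, Table 2 (`d = 2, k = 16`: `2.6939`).
* [WangHarringtonPreskill2003] C. Wang, J. Harrington, J. Preskill, Ann. Phys. 303 (2003) 31–58, abstract (`p_{c0} = .1031`).
-/

noncomputable section

namespace Summit.Ventures.QEC.Thresholds

open Filter Topology Finset Matrix
open Literature.InformationTheory.QuantumCodes
open Literature.InformationTheory.QuantumCodes.RotatedSurface
open Literature.InformationTheory.QuantumCodes.ToricCode (SAWCountBound)
open Literature.Probability.RandomPlanarGeometry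

/-! ### One logical qubit: failure of the `H_Z` sector leaves an odd row-`0` residual -/

/-- **Every non-trivial `X`-logical of `RSC(L)` is `col 0 +` an `X`-stabilizer** (`k = 1`). [cite: TomitaSvore2014, §2.2 (one logical qubit)]
[cite: DennisEtAl2002, §3.2 (logical paths of the planar code)] -/
theorem rsc_xlogical_add_col_mem {L : ℕ} (hL : 0 < L) {x : Fin L × Fin L → ZMod 2} (hx : HZ L *ᵥ x = 0)
    (hxS : x ∉ (RotatedSurface.code L).rowSpX) : x + RotatedSurface.col ⟨0, hL⟩ ∈ (RotatedSurface.code L).rowSpX := by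
  have h3 : Module.finrank (ZMod 2) (RotatedSurface.code L).kerZ -
      Module.finrank (ZMod 2) (RotatedSurface.code L).rowSpX = 1 := code_k hL
  set C := RotatedSurface.code L with hC
  set r₀ : Fin L × Fin L → ZMod 2 := RotatedSurface.col ⟨0, hL⟩ with hr₀
  have hWV : C.rowSpX ≤ C.kerZ := C.rowSpX_le_kerZ
  have hsV : r₀ ∈ C.kerZ := (C.mem_kerZ_iff _).2 (HZ_mulVec_col _)
  have hsW : r₀ ∉ C.rowSpX := by
    intro hmem
    have h1 : row ⟨0, hL⟩ ⬝ᵥ r₀ = 0 := dotProduct_eq_zero_of_mem_rowSpace hmem (HX_mulVec_row _)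
    rw [hr₀, row_dotProduct_col] at h1
    exact one_ne_zero h1
  have hxV : x ∈ C.kerZ := (C.mem_kerZ_iff _).2 hx
  have hW'V : C.rowSpX ⊔ (ZMod 2) ∙ r₀ ≤ C.kerZ := sup_le hWV ((Submodule.span_singleton_le_iff_mem _ _).2 hsV)
  have hlt : C.rowSpX < C.rowSpX ⊔ (ZMod 2) ∙ r₀ := by
    refine lt_of_le_of_ne le_sup_left fun h => hsW ?_
    rw [h]
    exact Submodule.mem_sup_right (Submodule.mem_span_singleton_self _)
  have h1 := Submodule.finrank_lt_finrank_of_lt hlt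
  have h2 := Submodule.finrank_mono hW'V
  have heq : C.rowSpX ⊔ (ZMod 2) ∙ r₀ = C.kerZ := Submodule.eq_of_le_of_finrank_eq hW'V (by omega)
  have hxW' : x ∈ C.rowSpX ⊔ (ZMod 2) ∙ r₀ := heq ▸ hxV
  obtain ⟨w, hw, t, ht, hwt⟩ := Submodule.mem_sup.1 hxW'
  obtain ⟨a, rfl⟩ := Submodule.mem_span_singleton.1 ht
  have hss : r₀ + r₀ = 0 := by
    funext q
    have : ∀ t : ZMod 2, t + t = 0 := by decide
    exact this _
  by_cases ha : a = 0
  · subst ha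
    rw [zero_smul, add_zero] at hwt
    exact absurd (hwt ▸ hw) hxS
  · have ha1 : a = 1 := by
      have key : ∀ a : ZMod 2, a ≠ 0 → a = 1 := by decide
      exact key a ha
    subst ha1
    rw [one_smul] at hwt
    rw [← hwt, add_assoc, hss, add_zero]
    exact hw

/-- The row-`0` parity of `x` is its pairing with the `Z`-logical `row 0`: `row 0 · x = Σ_j x(0, j)`.
[cite: DennisEtAl2002, §3.2 (X̄ and Z̄ paths cross once)] -/
theorem rsc_row_dotProduct {L : ℕ} (i : Fin L) (x : Fin L × Fin L → ZMod 2) :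
    RotatedSurface.row i ⬝ᵥ x = ∑ j : Fin L, x (i, j) := by
  classical
  simp only [dotProduct, Fintype.sum_prod_type]
  rw [Finset.sum_eq_single i]
  · simp [RotatedSurface.row]
  · intro y _ hy
    simp [RotatedSurface.row, hy]
  · intro h; exact absurd (Finset.mem_univ _) h

/-- **A non-trivial `X`-logical of `RSC(L)` has an odd number of row-`0` qubits.** [cite: DennisEtAl2002, §3.2 (a non-trivial relative cycle crosses the cut an odd number of times)] -/
theorem rsc_rowZero_eq_one {L : ℕ} (hL : 0 < L) {x : Fin L × Fin L → ZMod 2} (hx : HZ L *ᵥ x = 0)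
    (hxS : x ∉ (RotatedSurface.code L).rowSpX) : ∑ j : Fin L, x (⟨0, hL⟩, j) = 1 := by
  rw [← rsc_row_dotProduct]
  have hmem := rsc_xlogical_add_col_mem hL hx hxS
  have h1 : RotatedSurface.row ⟨0, hL⟩ ⬝ᵥ (x + RotatedSurface.col ⟨0, hL⟩) = 0 :=
    dotProduct_eq_zero_of_mem_rowSpace hmem (HX_mulVec_row _)
  rw [dotProduct_add, row_dotProduct_col] at h1
  have key : ∀ t : ZMod 2, t + 1 = 0 → t = 1 := by decide
  exact key _ h1

/-- **Failure ⇒ odd row-`0` residual** for a minimum-weight decoder of the `H_Z` sector of `RSC(L)`.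
[cite: DennisEtAl2002, §4.3 (success iff the residual is homologically trivial)] -/
theorem rsc_oddResidualZ_of_not_corrects {L : ℕ} (hL : 0 < L)
    {D : Decoder (Fin (L - 1) × Fin (L + 1) → ZMod 2) (Fin L × Fin L → ZMod 2)}
    (hD : D.IsMinWeight (fun e => HZ L *ᵥ e) {x | HZ L *ᵥ x = 0} hammingNorm) {e : Fin L × Fin L → ZMod 2}
    (hfail : ¬ D.Corrects (fun e => HZ L *ᵥ e) ((RotatedSurface.code L).rowSpX : Set (Fin L × Fin L → ZMod 2)) e) :
    ∑ j : Fin L, (D (HZ L *ᵥ e) + e) (⟨0, hL⟩, j) = 1 :=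
  rsc_rowZero_eq_one hL (hD.add_mem e) hfail

/-! ### The SAW-counting threshold of the `H_Z` sector, every size -/

open Classical in
/-- The `H_Z`-sector failure probability is at most the probability of an odd row-`0` residual.
[cite: DennisEtAl2002, §5.2 (Prob_fail ≤ the probability of a non-trivial relative polygon)] -/
theorem rsc_xFailureFamily_le_sum_oddResidual
    (D : ∀ i, Decoder (Fin (i + 1 - 1) × Fin (i + 1 + 1) → ZMod 2) (Fin (i + 1) × Fin (i + 1) → ZMod 2))
    (hD : ∀ i, (D i).IsMinWeight (rscCode i).xSyndrome ((rscCode i).kerZ : Set _) hammingNorm) (i : ℕ) {p : ℝ}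
    (hp0 : 0 ≤ p) (hp1 : p ≤ 1) :
    xFailureFamily rscCode D i p ≤ ∑ e ∈ univ.filter (fun e : Fin (i + 1) × Fin (i + 1) → ZMod 2 =>
      ∑ j : Fin (i + 1), (D i (HZ (i + 1) *ᵥ e) + e) (⟨0, by omega⟩, j) = 1), bernoulliWeight p (supp e) := by
  refine Finset.sum_le_sum_of_subset_of_nonneg (fun e he => ?_) fun e _ _ => bernoulliWeight_nonneg hp0 hp1 _
  rw [Finset.mem_filter] at he ⊢
  exact ⟨Finset.mem_univ _, rsc_oddResidualZ_of_not_corrects (by omega) (hD i) he.2⟩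

/-- **Below threshold for `4ν² p(1-p) < 1`** (given `cₙ ≤ C νⁿ`): every minimum-weight decoder family of the `H_Z` sector of
the rotated surface codes, every size. [cite: DennisEtAl2002, §5.3 eq. (threshold_2d)] -/
theorem rsc_x_belowThreshold_of_sawCountBound {C ν : ℝ} (hν : 0 < ν) (hC : SAWCountBound C ν)
    (D : ∀ i, Decoder (Fin (i + 1 - 1) × Fin (i + 1 + 1) → ZMod 2) (Fin (i + 1) × Fin (i + 1) → ZMod 2))
    (hD : ∀ i, (D i).IsMinWeight (rscCode i).xSyndrome ((rscCode i).kerZ : Set _) hammingNorm) {p : ℝ}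
    (hp0 : 0 ≤ p) (hp : p ≤ 1 / 2) (h4 : 4 * ν ^ 2 * (p * (1 - p)) < 1) :
    BelowThreshold (xFailureFamily rscCode D) p := by
  have ht := rsc_tendsto_sum_oddResidualZ hν hC D hD hp0 hp h4
  refine squeeze_zero' (Filter.Eventually.of_forall fun i => ?_)
    (Filter.Eventually.of_forall fun i => rsc_xFailureFamily_le_sum_oddResidual D hD i hp0 (by linarith)) ht
  exact Finset.sum_nonneg fun e _ => bernoulliWeight_nonneg hp0 (by linarith) _

/-- **`μ(ℤ²) ≤ μ' ⇒ p_c ≥ p₀(μ')`** for every minimum-weight decoder family of the `H_Z` sector of the rotated surface codes.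
[cite: DennisEtAl2002, §5.3 eqs. (saw_2), (threshold_2d)] -/
theorem rsc_x_isThresholdLowerBound_of_connectiveConstant_le {μ' : ℝ} (hμ'1 : 1 ≤ μ')
    (hμ : SAW.Zd.connectiveConstant 2 ≤ μ')
    (D : ∀ i, Decoder (Fin (i + 1 - 1) × Fin (i + 1 + 1) → ZMod 2) (Fin (i + 1) × Fin (i + 1) → ZMod 2))
    (hD : ∀ i, (D i).IsMinWeight (rscCode i).xSyndrome ((rscCode i).kerZ : Set _) hammingNorm) :
    IsThresholdLowerBound (xFailureFamily rscCode D) (thresholdValue μ') := by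
  refine isThresholdLowerBound_thresholdValue_of_forall_gt hμ'1 fun ν hν p hp0 hp h4 => ?_
  obtain ⟨C, hC⟩ := exists_sawCountBound_of_connectiveConstant_lt (lt_of_le_of_lt hμ hν)
  exact rsc_x_belowThreshold_of_sawCountBound (by linarith) hC D hD hp0 hp h4

/-- ★ **Rotated surface codes, `H_Z` sector, EVERY size: threshold `≥ p₀(2.6939)`** for every minimum-weight decoder family —
UNCONDITIONAL, tier CERTIFIED (kernel), from `μ(ℤ²) ≤ 2.6939`. [cite: DennisEtAl2002, §5.3 eq. (threshold_2d)]
[cite: PonitzTittmann2000, Table 2 (d = 2, k = 16)] -/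
theorem rsc_x_isThresholdLowerBound_kernelSymmK16
    (D : ∀ i, Decoder (Fin (i + 1 - 1) × Fin (i + 1 + 1) → ZMod 2) (Fin (i + 1) × Fin (i + 1) → ZMod 2))
    (hD : ∀ i, (D i).IsMinWeight (rscCode i).xSyndrome ((rscCode i).kerZ : Set _) hammingNorm) :
    IsThresholdLowerBound (xFailureFamily rscCode D) (thresholdValue 2.6939) :=
  rsc_x_isThresholdLowerBound_of_connectiveConstant_le (by norm_num) SAW.Zd.connectiveConstant_two_le_26939 D hD

/-- ★ **`p_c(RSC, H_Z sector) > .0357` for EVERY size** and every minimum-weight decoder family — UNCONDITIONAL, tier CERTIFIED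
(kernel); was `.0285` for even `L` (item 143) and `.0357` for odd `L` only (item 146). [cite: DennisEtAl2002, §5.3 eq. (p_c_2d)]
[cite: WangHarringtonPreskill2003, abstract (p_c0 = .1031 ± .0001, numerical)] -/
theorem rsc_x_accuracyThreshold_gt_0357
    (D : ∀ i, Decoder (Fin (i + 1 - 1) × Fin (i + 1 + 1) → ZMod 2) (Fin (i + 1) × Fin (i + 1) → ZMod 2))
    (hD : ∀ i, (D i).IsMinWeight (rscCode i).xSyndrome ((rscCode i).kerZ : Set _) hammingNorm) :
    (0.0357 : ℝ) < accuracyThreshold (xFailureFamily rscCode D) :=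
  lt_of_lt_of_le thresholdValue_26939_bounds.1
    (le_accuracyThreshold (rsc_x_isThresholdLowerBound_kernelSymmK16 D hD) ((thresholdValue_le_half _).trans (by norm_num)))

/-- Canonical instance: minimum-weight decoding of the `Z`-syndrome of the rotated surface codes has `p_c > .0357`, every size.
[cite: DennisEtAl2002, §5.1 (E_min) and §5.3] -/
theorem rsc_x_accuracyThreshold_minWeight_gt_0357 :
    (0.0357 : ℝ) < accuracyThreshold (xFailureFamily rscCode fun i => Decoder.minWeight (rscCode i).xSyndrome hammingNorm) :=
  rsc_x_accuracyThreshold_gt_0357 _ fun i => (rscCode i).isMinWeight_minWeight_xSyndrome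

open Classical in
/-- **Exponential decay below `p₀(ν)`** (given `cₙ ≤ C νⁿ`, `ν ≥ 1`), `H_Z` sector, every minimum-weight decoder family and every
`0 ≤ p < p₀(ν)`: `P_fail(i) ≤ C' r'^i` (from `P_fail ≤ L·C·r^L/(1-r)`, `L = i + 1 ≥ 2`). [cite: DennisEtAl2002, §5.3 eq. (fail_2d)] -/
theorem rsc_x_decaysExponentially_of_sawCountBound {C ν : ℝ} (hν : 1 ≤ ν) (hC : SAWCountBound C ν)
    (D : ∀ i, Decoder (Fin (i + 1 - 1) × Fin (i + 1 + 1) → ZMod 2) (Fin (i + 1) × Fin (i + 1) → ZMod 2))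
    (hD : ∀ i, (D i).IsMinWeight (rscCode i).xSyndrome ((rscCode i).kerZ : Set _) hammingNorm) {p : ℝ}
    (hp₀ : 0 ≤ p) (hpp : p < thresholdValue ν) : DecaysExponentially (xFailureFamily rscCode D) p := by
  have hp : p ≤ 1 / 2 := hpp.le.trans (thresholdValue_le_half ν)
  have hlt : p * (1 - p) < thresholdValue ν * (1 - thresholdValue ν) :=
    mul_one_sub_lt_mul_one_sub hpp (by linarith [thresholdValue_le_half ν])
  have hν0 : 0 < ν := lt_of_lt_of_le one_pos hν
  have h4 : 4 * ν ^ 2 * (p * (1 - p)) < 1 := by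
    calc 4 * ν ^ 2 * (p * (1 - p)) < 4 * ν ^ 2 * (thresholdValue ν * (1 - thresholdValue ν)) := by gcongr
      _ = 1 := four_mul_sq_mul_thresholdValue hν
  set s := Real.sqrt (p * (1 - p)) with hs
  set r := 2 * ν * s with hr
  have hpp' : 0 ≤ p * (1 - p) := mul_nonneg hp₀ (by linarith)
  have hr0 : 0 ≤ r := by rw [hr]; positivity
  have hr1 : r < 1 := by
    have hsq : r ^ 2 = 4 * ν ^ 2 * (p * (1 - p)) := by
      rw [hr, mul_pow, mul_pow, hs, Real.sq_sqrt hpp']; ring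
    have h' : r ^ 2 < 1 := by rw [hsq]; exact h4
    have := (sq_lt_one_iff_abs_lt_one r).1 h'
    rwa [abs_of_nonneg hr0] at this
  have h1r : 0 < 1 - r := by linarith
  refine decaysExponentially_of_eventually_abs_le (A := C * r / (1 - r)) (k := 1) hr0 hr1 ?_
  rw [Filter.eventually_atTop]
  refine ⟨1, fun i hi => ?_⟩
  have hnonneg : 0 ≤ xFailureFamily rscCode D i p :=
    Finset.sum_nonneg fun e _ => bernoulliWeight_nonneg hp₀ (by linarith) _
  rw [abs_of_nonneg hnonneg]
  have hb := (rsc_xFailureFamily_le_sum_oddResidual D hD i hp₀ (by linarith)).trans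
    (rsc_sum_bernoulliWeight_oddResidualZ_le (L := i + 1) (by omega) hν0 hC (hD i) hp₀ hp hr1)
  calc xFailureFamily rscCode D i p ≤ ((i + 1 : ℕ) : ℝ) * C * r ^ (i + 1) / (1 - r) := hb
    _ = C * r / (1 - r) * ((i : ℝ) + 1) ^ 1 * r ^ i := by
        push_cast
        rw [pow_one, pow_succ]
        field_simp

/-- **Exponential decay at every `0 ≤ p ≤ .0357`** for the `H_Z` sector of the rotated surface codes, every size, every
minimum-weight decoder family — UNCONDITIONAL, tier CERTIFIED (kernel) (walk-count constant at `ν = 2.694 > μ(ℤ²)`).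
[cite: DennisEtAl2002, §5.3 eq. (fail_2d)] -/
theorem rsc_x_decaysExponentially_0357
    (D : ∀ i, Decoder (Fin (i + 1 - 1) × Fin (i + 1 + 1) → ZMod 2) (Fin (i + 1) × Fin (i + 1) → ZMod 2))
    (hD : ∀ i, (D i).IsMinWeight (rscCode i).xSyndrome ((rscCode i).kerZ : Set _) hammingNorm) {p : ℝ}
    (hp₀ : 0 ≤ p) (hpp : p ≤ 0.0357) : DecaysExponentially (xFailureFamily rscCode D) p := by
  have hlt : SAW.Zd.connectiveConstant 2 < 2.694 := lt_of_le_of_lt SAW.Zd.connectiveConstant_two_le_26939 (by norm_num)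
  obtain ⟨C, hC⟩ := exists_sawCountBound_of_connectiveConstant_lt hlt
  have hval : (0.0357 : ℝ) < thresholdValue 2.694 := by
    unfold thresholdValue
    have : Real.sqrt (1 - 1 / (2.694 : ℝ) ^ 2) < 0.9286 := by
      rw [Real.sqrt_lt' (by norm_num)]
      norm_num
    linarith
  exact rsc_x_decaysExponentially_of_sawCountBound (by norm_num) hC D hD hp₀ (lt_of_le_of_lt hpp hval)

/-- ★ **Boundary-MWPM attains `p₀(2.6939)` on the `H_Z` sector of the rotated surface codes, every size** (every
graphlike-with-boundary presentation of `H_Z`, link metric, matching decoder) — UNCONDITIONAL, tier CERTIFIED (kernel).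
[cite: DennisEtAl2002, §5.1 (E_min by matching) and §5.3 eq. (threshold_2d)] -/
theorem rsc_x_mwpm_isThresholdLowerBound_kernelSymmK16
    {ι : ∀ i, Fin (i + 1) × Fin (i + 1) → Sym2 (Option (Fin (i + 1 - 1) × Fin (i + 1 + 1)))}
    (hι : ∀ i, IsGraphlikeVia (rscCode i).HZ (ι i)) (m : ∀ i, EdgeMetric (ι i))
    {D' : ∀ i, Decoder (Option (Fin (i + 1 - 1) × Fin (i + 1 + 1)) → ZMod 2) (Fin (i + 1) × Fin (i + 1) → ZMod 2)}
    (hD : ∀ i, IsMatchingDecoder (m i) (D' i)) :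
    IsThresholdLowerBound (xFailureFamily rscCode fun i => boundaryDecoder (D' i)) (thresholdValue 2.6939) :=
  rsc_x_isThresholdLowerBound_kernelSymmK16 _ fun i => isMinWeight_boundaryDecoder (hι i) (hD i)

/-- **`p_c^{MWPM} > .0357` for the `H_Z` sector of the rotated surface codes, every size**, every boundary-MWPM family —
UNCONDITIONAL, tier CERTIFIED (kernel). [cite: DennisEtAl2002, §5.3 eq. (p_c_2d)] -/
theorem rsc_x_mwpm_accuracyThreshold_gt_0357
    {ι : ∀ i, Fin (i + 1) × Fin (i + 1) → Sym2 (Option (Fin (i + 1 - 1) × Fin (i + 1 + 1)))}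
    (hι : ∀ i, IsGraphlikeVia (rscCode i).HZ (ι i)) (m : ∀ i, EdgeMetric (ι i))
    {D' : ∀ i, Decoder (Option (Fin (i + 1 - 1) × Fin (i + 1 + 1)) → ZMod 2) (Fin (i + 1) × Fin (i + 1) → ZMod 2)}
    (hD : ∀ i, IsMatchingDecoder (m i) (D' i)) :
    (0.0357 : ℝ) < accuracyThreshold (xFailureFamily rscCode fun i => boundaryDecoder (D' i)) :=
  rsc_x_accuracyThreshold_gt_0357 _ fun i => isMinWeight_boundaryDecoder (hι i) (hD i)

/-! ### Both sectors; depolarizing noise — every size -/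

/-- **Both sectors at once, every size**: for every `0 ≤ p < .0357`, every pair of minimum-weight decoder families of the
rotated surface codes has BOTH logical failure probabilities `→ 0` — UNCONDITIONAL, tier CERTIFIED (kernel).
[cite: DennisEtAl2002, §4.1 (X and Z errors corrected separately) and §5.3] -/
theorem rsc_bothSectors_belowThreshold_0357
    (DZ : ∀ i, Decoder (Fin (i + 1 + 1) × Fin (i + 1 - 1) → ZMod 2) (Fin (i + 1) × Fin (i + 1) → ZMod 2))
    (hDZ : ∀ i, (DZ i).IsMinWeight (rscCode i).zSyndrome ((rscCode i).kerX : Set _) hammingNorm)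
    (DX : ∀ i, Decoder (Fin (i + 1 - 1) × Fin (i + 1 + 1) → ZMod 2) (Fin (i + 1) × Fin (i + 1) → ZMod 2))
    (hDX : ∀ i, (DX i).IsMinWeight (rscCode i).xSyndrome ((rscCode i).kerZ : Set _) hammingNorm)
    {p : ℝ} (hp₀ : 0 ≤ p) (hpp : p < 0.0357) :
    BelowThreshold (zFailureFamily rscCode DZ) p ∧ BelowThreshold (xFailureFamily rscCode DX) p :=
  ⟨(rsc_z_isThresholdLowerBound_kernelSymmK16 DZ hDZ).anti thresholdValue_26939_bounds.1.le p hp₀ hpp,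
    (rsc_x_isThresholdLowerBound_kernelSymmK16 DX hDX).anti thresholdValue_26939_bounds.1.le p hp₀ hpp⟩

/-- ★ **Depolarizing threshold `≥ (3/2)·p₀(2.6939)` for the rotated surface codes, EVERY size**, decoded sector-wise by ANY pair
of minimum-weight decoder families — UNCONDITIONAL, tier CERTIFIED (kernel); was `(3/2)·p₀(3)` (item 143) for even `L`.
[cite: DennisEtAl2002, §4.1 (depolarizing channel; X and Z errors corrected separately)] -/
theorem rsc_depolarizing_isThresholdLowerBound_kernelSymmK16
    (DX : ∀ i, Decoder (Fin (i + 1 - 1) × Fin (i + 1 + 1) → ZMod 2) (Fin (i + 1) × Fin (i + 1) → ZMod 2))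
    (DZ : ∀ i, Decoder (Fin (i + 1 + 1) × Fin (i + 1 - 1) → ZMod 2) (Fin (i + 1) × Fin (i + 1) → ZMod 2))
    (hDX : ∀ i, (DX i).IsMinWeight (rscCode i).xSyndrome ((rscCode i).kerZ : Set _) hammingNorm)
    (hDZ : ∀ i, (DZ i).IsMinWeight (rscCode i).zSyndrome ((rscCode i).kerX : Set _) hammingNorm) :
    IsThresholdLowerBound (depolarizingFailureFamily rscCode DX DZ) (3 / 2 * thresholdValue 2.6939) := by
  have h := depolarizing_isThresholdLowerBound rscCode DX DZ (rsc_x_isThresholdLowerBound_kernelSymmK16 DX hDX)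
    (rsc_z_isThresholdLowerBound_kernelSymmK16 DZ hDZ) ((min_le_left _ _).trans (thresholdValue_le_two_thirds _))
  rwa [min_self] at h

/-- ★ **`p_c^depol(RSC(L)) > .0535` for EVERY size** (decimal, kernel; was `.0427`) under sector-wise minimum-weight decoding of
depolarizing noise (`(3/2) · .0357 = .05355`). [cite: DennisEtAl2002, §4.1 and §5.3 eq. (p_c_2d)] -/
theorem rsc_depolarizing_accuracyThreshold_gt_0535
    (DX : ∀ i, Decoder (Fin (i + 1 - 1) × Fin (i + 1 + 1) → ZMod 2) (Fin (i + 1) × Fin (i + 1) → ZMod 2))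
    (DZ : ∀ i, Decoder (Fin (i + 1 + 1) × Fin (i + 1 - 1) → ZMod 2) (Fin (i + 1) × Fin (i + 1) → ZMod 2))
    (hDX : ∀ i, (DX i).IsMinWeight (rscCode i).xSyndrome ((rscCode i).kerZ : Set _) hammingNorm)
    (hDZ : ∀ i, (DZ i).IsMinWeight (rscCode i).zSyndrome ((rscCode i).kerX : Set _) hammingNorm) :
    (0.0535 : ℝ) < accuracyThreshold (depolarizingFailureFamily rscCode DX DZ) := by
  have h := thresholdValue_26939_bounds.1
  refine lt_of_lt_of_le (by linarith)
    (le_accuracyThreshold (rsc_depolarizing_isThresholdLowerBound_kernelSymmK16 DX DZ hDX hDZ) ?_)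
  have := thresholdValue_le_half (2.6939 : ℝ)
  linarith

/-- Canonical instance: minimum-weight decoding of both syndromes of the rotated surface codes has depolarizing threshold
`> .0535`, every size. [cite: DennisEtAl2002, §4.1 and §5.1] -/
theorem rsc_depolarizing_accuracyThreshold_minWeight_gt_0535 :
    (0.0535 : ℝ) < accuracyThreshold
      (depolarizingFailureFamily rscCode (fun i => Decoder.minWeight (rscCode i).xSyndrome hammingNorm)
        fun i => Decoder.minWeight (rscCode i).zSyndrome hammingNorm) :=
  rsc_depolarizing_accuracyThreshold_gt_0535 _ _ (fun i => (rscCode i).isMinWeight_minWeight_xSyndrome)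
    fun i => (rscCode i).isMinWeight_minWeight_zSyndrome

/-- ★ **`(3/2)·p₀(2.6939) ≤ p_c^depol ≤ 3/8` for EVERY size** (`.0535 < p_c^depol ≤ .375`): the floor above with lit-2's
erasure-decomposition ceiling (`k = 1`), a certified two-sided window for the whole rotated family.
[cite: DennisEtAl2002, §4.1 and §4.6] -/
theorem rsc_depolarizing_accuracyThreshold_mem_kernelSymmK16
    (DX : ∀ i, Decoder (Fin (i + 1 - 1) × Fin (i + 1 + 1) → ZMod 2) (Fin (i + 1) × Fin (i + 1) → ZMod 2))
    (DZ : ∀ i, Decoder (Fin (i + 1 + 1) × Fin (i + 1 - 1) → ZMod 2) (Fin (i + 1) × Fin (i + 1) → ZMod 2))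
    (hDX : ∀ i, (DX i).IsMinWeight (rscCode i).xSyndrome ((rscCode i).kerZ : Set _) hammingNorm)
    (hDZ : ∀ i, (DZ i).IsMinWeight (rscCode i).zSyndrome ((rscCode i).kerX : Set _) hammingNorm) :
    3 / 2 * thresholdValue 2.6939 ≤ accuracyThreshold (depolarizingFailureFamily rscCode DX DZ) ∧
      accuracyThreshold (depolarizingFailureFamily rscCode DX DZ) ≤ 3 / 8 := by
  refine ⟨le_accuracyThreshold (rsc_depolarizing_isThresholdLowerBound_kernelSymmK16 DX DZ hDX hDZ) ?_,
    depolarizingAccuracyThreshold_le_three_eighths rscCode (fun i => ?_) DX DZ⟩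
  · have := thresholdValue_le_half (2.6939 : ℝ)
    linarith
  · rw [show (rscCode i).k = 1 from code_k (by omega)]
    norm_num

/-! ### Boundary MWPM on both syndromes, depolarizing noise (appended) -/

/-- ★ **Boundary-MWPM on both syndromes attains `(3/2)·p₀(2.6939)` under depolarizing noise, EVERY size** (every
graphlike-with-boundary presentation of `H_Z` and of `H_X`, link metrics, matching decoders) — UNCONDITIONAL, tier CERTIFIED
(kernel). [cite: DennisEtAl2002, §4.1 (X and Z errors corrected separately) and §5.1 (E_min by matching)] -/
theorem rsc_depolarizing_mwpm_isThresholdLowerBound_kernelSymmK16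
    {ιX : ∀ i, Fin (i + 1) × Fin (i + 1) → Sym2 (Option (Fin (i + 1 - 1) × Fin (i + 1 + 1)))}
    (hιX : ∀ i, IsGraphlikeVia (rscCode i).HZ (ιX i)) (mX : ∀ i, EdgeMetric (ιX i))
    {DX' : ∀ i, Decoder (Option (Fin (i + 1 - 1) × Fin (i + 1 + 1)) → ZMod 2) (Fin (i + 1) × Fin (i + 1) → ZMod 2)}
    (hDX : ∀ i, IsMatchingDecoder (mX i) (DX' i))
    {ιZ : ∀ i, Fin (i + 1) × Fin (i + 1) → Sym2 (Option (Fin (i + 1 + 1) × Fin (i + 1 - 1)))}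
    (hιZ : ∀ i, IsGraphlikeVia (rscCode i).HX (ιZ i)) (mZ : ∀ i, EdgeMetric (ιZ i))
    {DZ' : ∀ i, Decoder (Option (Fin (i + 1 + 1) × Fin (i + 1 - 1)) → ZMod 2) (Fin (i + 1) × Fin (i + 1) → ZMod 2)}
    (hDZ : ∀ i, IsMatchingDecoder (mZ i) (DZ' i)) :
    IsThresholdLowerBound (depolarizingFailureFamily rscCode (fun i => boundaryDecoder (DX' i))
      fun i => boundaryDecoder (DZ' i)) (3 / 2 * thresholdValue 2.6939) :=
  rsc_depolarizing_isThresholdLowerBound_kernelSymmK16 _ _ (fun i => isMinWeight_boundaryDecoder (hιX i) (hDX i))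
    fun i => isMinWeight_boundaryDecoder (hιZ i) (hDZ i)

/-- ★ **`p_c^{depol,MWPM}(RSC(L)) > .0535` for EVERY size**: boundary-MWPM on both syndromes of the rotated surface codes under
depolarizing noise — UNCONDITIONAL, tier CERTIFIED (kernel). [cite: DennisEtAl2002, §4.1 and §5.3 eq. (p_c_2d)] -/
theorem rsc_depolarizing_mwpm_accuracyThreshold_gt_0535
    {ιX : ∀ i, Fin (i + 1) × Fin (i + 1) → Sym2 (Option (Fin (i + 1 - 1) × Fin (i + 1 + 1)))}
    (hιX : ∀ i, IsGraphlikeVia (rscCode i).HZ (ιX i)) (mX : ∀ i, EdgeMetric (ιX i))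
    {DX' : ∀ i, Decoder (Option (Fin (i + 1 - 1) × Fin (i + 1 + 1)) → ZMod 2) (Fin (i + 1) × Fin (i + 1) → ZMod 2)}
    (hDX : ∀ i, IsMatchingDecoder (mX i) (DX' i))
    {ιZ : ∀ i, Fin (i + 1) × Fin (i + 1) → Sym2 (Option (Fin (i + 1 + 1) × Fin (i + 1 - 1)))}
    (hιZ : ∀ i, IsGraphlikeVia (rscCode i).HX (ιZ i)) (mZ : ∀ i, EdgeMetric (ιZ i))
    {DZ' : ∀ i, Decoder (Option (Fin (i + 1 + 1) × Fin (i + 1 - 1)) → ZMod 2) (Fin (i + 1) × Fin (i + 1) → ZMod 2)}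
    (hDZ : ∀ i, IsMatchingDecoder (mZ i) (DZ' i)) :
    (0.0535 : ℝ) < accuracyThreshold (depolarizingFailureFamily rscCode (fun i => boundaryDecoder (DX' i))
      fun i => boundaryDecoder (DZ' i)) :=
  rsc_depolarizing_accuracyThreshold_gt_0535 _ _ (fun i => isMinWeight_boundaryDecoder (hιX i) (hDX i))
    fun i => isMinWeight_boundaryDecoder (hιZ i) (hDZ i)

end Summit.Ventures.QEC.Thresholds
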